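import Summits.NavierStokesRegularity.FluidComputer.StrainSupFace
import Summits.NavierStokesRegularity.NavierStokesRegularity.Theorems.PlaneStrainDoorTypeFreeRungSharp
import Summits.NavierStokesRegularity.NavierStokesRegularity.Theorems.FluidComputerCascade
import HarnessLib

/-!
# Fluid computer — L64: THE TYPE-I THRESHOLD OF THE STRAIN FACE, CONSTANT ONE QUARTER:
# `limsup_{t↑T} (T − t)·sup_x λ₂(∇u(t, x)) ≥ 1/4` (the middle eigenvalue of the strain)

HONEST FRAMING (cell `pub-fluidc`, verbatim): *low prior, high value-of-information experiment on Tao's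
machine paradigm; NOT a claim that NS blows up.* Theorem side of the cell (the level dictionary); nothing here is
evidence of blow-up — necessities for EVERY maximal smooth finite-energy solution on `ℝ³`.

L41″ (`StrainSupFace`) is the Beale–Kato–Majda row of the strain: `∫_{t₀}^T sup_x λ₂⁺ dt = ∞` on every terminal
window, `λ₂` the middle eigenvalue of the strain (Neustupa–Penel / Miller, `q = ∞`), no constants. The sibling cell
`pub-nsreg` PROVED the sharp quantitative rung behind it (`hasSmoothExtensionPast_of_middleEigenvalue_le_typeI_sharp`,
`Theorems/PlaneStrainDoorTypeFreeRungSharp`): a classical Leray–Hopf solution on `ℝ³ × [0, T)` with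
`λ₂(∇u(t, x)) ≤ ε/(T − t)` on `[0, T) × ℝ³` (two-frame Courant–Fischer form) and `0 ≤ ε < 1/4` extends smoothly past `T`
— Miller's sharp enstrophy law `‖∇u(t)‖² ≤ ‖∇u(t₀)‖² exp(2∫λ₂⁺)` (`∂ₜ‖S‖² ≤ 2 sup λ₂⁺ ‖S‖²`) against Leray's necessary
rate `‖∇u(t)‖² ≳ ν^{3/2}(T − t)^{−1/2}` (L19): `(T − t)^{−2ε}` beats `(T − t)^{−1/2}` iff `ε < 1/4`. Read on the class of
the dictionary (restart at a good Leray–Hopf time, translate, maximality), for every maximal smooth solution `(u, p)` of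
the unforced Navier–Stokes system on `ℝ³ × [0, T)` (`ν > 0`), Leray–Hopf from `u 0`:

* `ns_midStrain_typeI_threshold` (**L64 — THE STRAIN TYPE-I THRESHOLD, CONSTANT `1/4`**): for every `ε < 1/4` and every
  `a ∈ [0, T)` there are `t ∈ [a, T)` and `x` at which EVERY 2-plane carries a direction `ξ` with
  `⟪∇u(t, x)ξ, ξ⟫ > ε/(T − t)·|ξ|²` — i.e. `λ₂(∇u(t, x)) > ε/(T − t)` (Courant–Fischer), so
  `limsup_{t↑T} (T − t)·sup_x λ₂(t, x) ≥ 1/4`;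
* `ns_midStrain_typeI_majorant` — majorant form: for every time-only Courant–Fischer majorant `m` of `λ₂` on `[0, T)` (as in
  L41″), every `ε < 1/4` and every `a ∈ [0, T)`, some `t ∈ [a, T)` has `ε < (T − t)·m(t)`;
* `ns_midStrain_typeI_frequently` — filter form of the majorant statement (`∃ᶠ t in 𝓝[<] T, ε < (T − t)·m(t)`);
* `ns_midStrain_typeI_threshold_of_cascadeWitness` — the interface reading.

Placement in the dictionary: L63 says `(T − t)‖∇u(t)‖_∞ ≥ 1 − o(1)` along a sequence; L64 bounds the SMALLER, SIGNED
quantity `λ₂ ≤ λ₃ ≤ |S| ≤ |∇u|` — the SHEET-FORMING strain rate — by a quarter of the self-similar rate `1/(T − t)`,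
along a sequence: a design whose maximal middle strain rate settles below `1/(4(T − t))` is not approaching a
singularity at `T`, however large its vorticity or its tube-forming (`λ₂ ≤ 0`) strain. HONEST PLACEMENT: the mechanism
is Miller 2020, Thm. 1.1 (`q = ∞`) with the sharp constant, combined with Leray's rate through the tree's `H¹`-restart
(nsreg-p6's rung, threshold `1/4`, matching the torus rung); the Type-I form with the explicit `1/4` was not located in
print (Miller states `limsup ‖λ₂⁺‖_{L^{3/2}} = ∞` and mixed-norm criteria, no `(T − t)` rate for `sup λ₂⁺`). A bound at
EVERY `t`, or a threshold above `1/4`, is NOT claimed. Necessity only. 0 sorry; no definitions; no named facts.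

## References

* E. Miller, Arch. Ration. Mech. Anal. 237 (2020) 1237–1263 = arXiv:1710.05569, Thm. 1.1 and the enstrophy identity
  (proof of Thm. 5.2). [Miller2019]
* J. Neustupa, P. Penel, in *Mathematical Fluid Mechanics*, Birkhäuser 2001, 237–265, Thm. 2. [NeustupaPenel2001]
* J. Leray, Acta Math. 63 (1934) 193–248, §20 (the `H¹` rate). [Leray1934]
* J. C. Robinson, J. L. Rodrigo, W. Sadowski, *The Three-Dimensional Navier–Stokes Equations*, CUP 2016, Lemma 6.11,
  Lemma 8.16. [RobinsonRodrigoSadowski2016]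
-/

noncomputable section

open MeasureTheory Set Function Filter Topology Metric InnerProductSpace
open scoped ENNReal NNReal RealInnerProductSpace
open Literature.Analysis.FluidPDE Literature.Analysis.FunctionSpaces
open Literature.Analysis.FluidPDE.FluidComputer
open Summit.NavierStokesRegularity.NavierStokesRegularity.Theorems.FluidComputer (x5a_of_cascadeWitness')
open Summit.NavierStokesRegularity.NavierStokesRegularity.Theorems.PlaneStrainDoorTypeFreeRungSharp
  (hasSmoothExtensionPast_of_middleEigenvalue_le_typeI_sharp)

namespace Summit.NavierStokesRegularity.FluidComputer.StrainTypeIFace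

/-! ## L64: the Type-I threshold of the middle strain eigenvalue -/

/-- **L64 — THE STRAIN TYPE-I THRESHOLD, CONSTANT ONE QUARTER.** For every `ν > 0`, `T > 0`, every maximal smooth
solution `(u, p)` of the unforced Navier–Stokes system on `ℝ³ × [0, T)` which is Leray–Hopf from `u 0`, every
`ε < 1/4` and every `a ∈ [0, T)`, there are `t ∈ [a, T)` and `x ∈ ℝ³` such that for EVERY orthonormal pair `v, w`
some `ξ = αv + βw` has `ε/(T − t)·(α² + β²) < ⟪∇u(t, x)ξ, ξ⟫` — in Courant–Fischer words `λ₂(∇u(t, x)) > ε/(T − t)`,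
the middle eigenvalue of the strain: `limsup_{t↑T} (T − t)·sup_x λ₂ ≥ 1/4`. Proof: otherwise `λ₂ ≤ ε₊/(T − t)` on
`[a, T) × ℝ³` (`ε₊ = max ε 0 < 1/4`) in two-frame form; restart at a good Leray–Hopf time `s ∈ (a, T)`
(`exists_isLerayHopfOn_restart_Ioo`): the translate `u(· + s)` is classical on `[0, T − s)`, Leray–Hopf from `u(s)`, with
the majorant `ε₊/((T − s) − τ)` on all of `[0, T − s)`, so the sharp rung
`hasSmoothExtensionPast_of_middleEigenvalue_le_typeI_sharp` (Miller's `exp(2∫λ₂⁺)` law against Leray's `H¹` rate)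
extends it past `T − s` — against the maximality of the translate (`IsMaximalSmoothSolution.translate_zero`).
Necessity only; not claimed at every `t`, and `1/4` is not claimed optimal. [cite: Miller2019, Thm 1.1]
[cite: NeustupaPenel2001, Thm 2] [cite: Leray1934, §20] -/
theorem ns_midStrain_typeI_threshold {ν T : ℝ} (hν : 0 < ν)
    {u : ℝ → EuclideanSpace ℝ (Fin 3) → EuclideanSpace ℝ (Fin 3)} {p : ℝ → EuclideanSpace ℝ (Fin 3) → ℝ}
    (hmax : IsMaximalSmoothSolution ν 0 u p T) (hLH : IsLerayHopfOn T ν 0 (u 0) u)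
    {ε : ℝ} (hε : ε < 1 / 4) {a : ℝ} (ha : a ∈ Ico 0 T) :
    ∃ t ∈ Ico a T, ∃ x : EuclideanSpace ℝ (Fin 3), ∀ v w : EuclideanSpace ℝ (Fin 3), ‖v‖ = 1 → ‖w‖ = 1 →
      ⟪v, w⟫ = 0 → ∃ α β : ℝ,
        ε / (T - t) * (α ^ 2 + β ^ 2) < ⟪fderiv ℝ (u t) x (α • v + β • w), α • v + β • w⟫ := by
  by_contra hno
  push Not at hno
  -- the nonnegative level `ε₊ = max ε 0 < 1/4` majorises as well
  set ε' : ℝ := max ε 0 with hε'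
  have hε'0 : 0 ≤ ε' := le_max_right _ _
  have hε'4 : ε' < 1 / 4 := max_lt hε (by norm_num)
  have hmaj : ∀ t ∈ Ico a T, ∀ x, ∃ v w : EuclideanSpace ℝ (Fin 3), ‖v‖ = 1 ∧ ‖w‖ = 1 ∧ ⟪v, w⟫ = 0 ∧
      ∀ α β : ℝ, ⟪fderiv ℝ (u t) x (α • v + β • w), α • v + β • w⟫ ≤ ε' / (T - t) * (α ^ 2 + β ^ 2) := by
    intro t ht x
    obtain ⟨v, w, hv, hw, hvw, hq⟩ := hno t ht x
    refine ⟨v, w, hv, hw, hvw, fun α β => (hq α β).trans ?_⟩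
    have hTt : 0 < T - t := sub_pos.2 ht.2
    exact mul_le_mul_of_nonneg_right (div_le_div_of_nonneg_right (le_max_left _ _) hTt.le) (by positivity)
  -- restart at a good Leray–Hopf time `s ∈ (a, T)` and translate
  obtain ⟨s, hs, hLHs⟩ := hLH.exists_isLerayHopfOn_restart_Ioo hν.le ha.1 ha.2 le_rfl
  have hs0 : 0 < s := ha.1.trans_lt hs.1
  have hTs : 0 < T - s := sub_pos.2 hs.2
  have hmaxs : IsMaximalSmoothSolution ν 0 (fun t => u (t + s)) (fun t => p (t + s)) (T - s) :=
    hmax.translate_zero hs0 hs.2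
  have hLH' : IsLerayHopfOn (T - s) ν 0 ((fun t => u (t + s)) 0) (fun t => u (t + s)) := by
    show IsLerayHopfOn (T - s) ν 0 (u (0 + s)) (fun t => u (t + s))
    rw [zero_add]
    exact hLHs
  have hmaj' : ∀ t ∈ Ico 0 (T - s), ∀ x, ∃ v w : EuclideanSpace ℝ (Fin 3), ‖v‖ = 1 ∧ ‖w‖ = 1 ∧ ⟪v, w⟫ = 0 ∧
      ∀ α β : ℝ, ⟪fderiv ℝ ((fun t => u (t + s)) t) x (α • v + β • w), α • v + β • w⟫ ≤
        ε' / (T - s - t) * (α ^ 2 + β ^ 2) := by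
    intro t ht x
    have h := hmaj (t + s) ⟨by linarith [ht.1, hs.1], by linarith [ht.2]⟩ x
    have e : T - (t + s) = T - s - t := by ring
    rw [e] at h
    exact h
  exact hmaxs.2 (hasSmoothExtensionPast_of_middleEigenvalue_le_typeI_sharp hν hTs hε'0 hε'4 hmaxs.1 hLH' hmaj')

/-- **L64, majorant form** (the quantitative endpoint of L41″): for every `ν > 0`, `T > 0`, every maximal smooth
Leray–Hopf solution of the unforced system, every time-only Courant–Fischer majorant `m` of the middle strain
eigenvalue on `[0, T) × ℝ³` (at each `(t, x)` an orthonormal pair `v, w` with `⟪∇u(t, x)ξ, ξ⟫ ≤ m(t)|ξ|²` on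
`span{v, w}`; e.g. `m(t) = sup_x λ₂⁺(t, x)` when finite), every `ε < 1/4` and every `a ∈ [0, T)`: some `t ∈ [a, T)` has
`ε < (T − t)·m(t)` — `limsup_{t↑T} (T − t)·m(t) ≥ 1/4`. (At the point of `ns_midStrain_typeI_threshold` the majorising
plane carries a direction with `ε/(T − t)|ξ|² < ⟪∇u ξ, ξ⟫ ≤ m(t)|ξ|²`.) [cite: Miller2019, Thm 1.1]
[cite: NeustupaPenel2001, Thm 2] -/
theorem ns_midStrain_typeI_majorant {ν T : ℝ} (hν : 0 < ν)
    {u : ℝ → EuclideanSpace ℝ (Fin 3) → EuclideanSpace ℝ (Fin 3)} {p : ℝ → EuclideanSpace ℝ (Fin 3) → ℝ}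
    (hmax : IsMaximalSmoothSolution ν 0 u p T) (hLH : IsLerayHopfOn T ν 0 (u 0) u)
    {m : ℝ → ℝ}
    (hmaj : ∀ t ∈ Ico 0 T, ∀ x, ∃ v w : EuclideanSpace ℝ (Fin 3), ‖v‖ = 1 ∧ ‖w‖ = 1 ∧
      ⟪v, w⟫ = 0 ∧ ∀ α β : ℝ,
        ⟪fderiv ℝ (u t) x (α • v + β • w), α • v + β • w⟫ ≤ m t * (α ^ 2 + β ^ 2))
    {ε : ℝ} (hε : ε < 1 / 4) {a : ℝ} (ha : a ∈ Ico 0 T) :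
    ∃ t ∈ Ico a T, ε < (T - t) * m t := by
  obtain ⟨t, ht, x, hx⟩ := ns_midStrain_typeI_threshold hν hmax hLH hε ha
  refine ⟨t, ht, ?_⟩
  have hTt : 0 < T - t := sub_pos.2 ht.2
  obtain ⟨v, w, hv, hw, hvw, hq⟩ := hmaj t ⟨ha.1.trans ht.1, ht.2⟩ x
  obtain ⟨α, β, hlt⟩ := hx v w hv hw hvw
  have h1 : ε / (T - t) * (α ^ 2 + β ^ 2) < m t * (α ^ 2 + β ^ 2) := hlt.trans_le (hq α β)
  have hpos : 0 < α ^ 2 + β ^ 2 := by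
    by_contra h0
    have h00 : α ^ 2 + β ^ 2 = 0 := le_antisymm (not_lt.1 h0) (by positivity)
    rw [h00, mul_zero, mul_zero] at h1
    exact lt_irrefl _ h1
  have h2 : ε / (T - t) < m t := lt_of_mul_lt_mul_right h1 hpos.le
  rw [div_lt_iff₀ hTt] at h2
  linarith

/-- **L64, filter form**: with the data of `ns_midStrain_typeI_majorant`, for every `ε < 1/4`:
`∃ᶠ t in 𝓝[<] T, ε < (T − t)·m(t)`. [cite: Miller2019, Thm 1.1] -/
theorem ns_midStrain_typeI_frequently {ν T : ℝ} (hν : 0 < ν) (hT : 0 < T)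
    {u : ℝ → EuclideanSpace ℝ (Fin 3) → EuclideanSpace ℝ (Fin 3)} {p : ℝ → EuclideanSpace ℝ (Fin 3) → ℝ}
    (hmax : IsMaximalSmoothSolution ν 0 u p T) (hLH : IsLerayHopfOn T ν 0 (u 0) u)
    {m : ℝ → ℝ}
    (hmaj : ∀ t ∈ Ico 0 T, ∀ x, ∃ v w : EuclideanSpace ℝ (Fin 3), ‖v‖ = 1 ∧ ‖w‖ = 1 ∧
      ⟪v, w⟫ = 0 ∧ ∀ α β : ℝ,
        ⟪fderiv ℝ (u t) x (α • v + β • w), α • v + β • w⟫ ≤ m t * (α ^ 2 + β ^ 2))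
    {ε : ℝ} (hε : ε < 1 / 4) :
    ∃ᶠ t in 𝓝[<] T, ε < (T - t) * m t := by
  rw [Filter.frequently_iff]
  intro U hU
  obtain ⟨l, hl, hlU⟩ := mem_nhdsLT_iff_exists_Ioo_subset.1 hU
  set a : ℝ := (max l 0 + T) / 2 with hadef
  have hm : max l 0 < T := max_lt hl hT
  have ha : a ∈ Ico 0 T := ⟨by rw [hadef]; linarith [le_max_right l 0], by rw [hadef]; linarith⟩
  have hla : l < a := by rw [hadef]; linarith [le_max_left l 0]
  obtain ⟨t, ht, hx⟩ := ns_midStrain_typeI_majorant hν hmax hLH hmaj hε ha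
  exact ⟨t, hlU ⟨hla.trans_le ht.1, ht.2⟩, hx⟩

/-! ## The interface reading -/

/-- **L64 READ ON THE INTERFACE: every cascade witness has `limsup_{t↑T} (T − t)·sup_x λ₂ ≥ 1/4`.** Every
`W : CascadeWitness` yields `ν > 0`, `T > 0` and a maximal smooth solution `(u, p)` of the unforced Navier–Stokes system
on `ℝ³ × [0, T)`, Leray–Hopf from `u 0` (`x5a_of_cascadeWitness'`), such that for every `ε < 1/4` and every `a ∈ [0, T)`
some `(t, x)`, `t ∈ [a, T)`, has, on every 2-plane, a direction with `⟪∇u(t, x)ξ, ξ⟫ > ε/(T − t)|ξ|²`.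
[cite: Miller2019, Thm 1.1] [cite: NeustupaPenel2001, Thm 2] -/
theorem ns_midStrain_typeI_threshold_of_cascadeWitness (W : CascadeWitness) :
    ∃ ν : ℝ, 0 < ν ∧ ∃ T : ℝ, 0 < T ∧
      ∃ (u : ℝ → EuclideanSpace ℝ (Fin 3) → EuclideanSpace ℝ (Fin 3)) (p : ℝ → EuclideanSpace ℝ (Fin 3) → ℝ),
        IsMaximalSmoothSolution ν 0 u p T ∧ IsLerayHopfOn T ν 0 (u 0) u ∧
        ∀ ε : ℝ, ε < 1 / 4 → ∀ a ∈ Ico 0 T,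
          ∃ t ∈ Ico a T, ∃ x : EuclideanSpace ℝ (Fin 3), ∀ v w : EuclideanSpace ℝ (Fin 3), ‖v‖ = 1 → ‖w‖ = 1 →
            ⟪v, w⟫ = 0 → ∃ α β : ℝ,
              ε / (T - t) * (α ^ 2 + β ^ 2) < ⟪fderiv ℝ (u t) x (α • v + β • w), α • v + β • w⟫ := by
  obtain ⟨ν, hν, T, hT, u, p, hmax, hLH, -⟩ := x5a_of_cascadeWitness' W
  exact ⟨ν, hν, T, hT, u, p, hmax, hLH, fun _ hε _ ha => ns_midStrain_typeI_threshold hν hmax hLH hε ha⟩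

end Summit.NavierStokesRegularity.FluidComputer.StrainTypeIFace

end
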